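import Summits.Ventures.CertifiedManyBodySolver.Upper.BlochDressedQFCertificateTTPrime
import HarnessLib

/-!
# Ventures/CertifiedManyBodySolver — Upper/BlochDressedQFPlaneTTPrime.lean

HONEST FRAMING: first certified bounds; not a superconductivity verdict; every number certified or labelled float.

THE `t–t'` DRESSED CELL ENERGY AS A NAMED FUNCTION AND ITS AFFINE READ-OFF (hubbard-fast-atlas-2; the plane-node end of the `t–t'`
twin chain `Upper/BlochDressed*TTPrime.lean`). The right-hand side of `energyDensityTT'_le_qfpCellEnergyTT'` is an explicit finite
expression in the kernel entries, the gates and `slaterRDM`, AFFINE in `(t, t', U)` because a fixed state's energy is; here it gets a name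
and the affine read-off, so that a KERNEL-DATA claim node can cite three reader-evaluated rationals `(A, B, D)`:
* `qfpCellEnergyTT' hq0 γ v t t' U` — the dressed cell energy per site on a kernel `γ σ R` (definition = the theorem's right-hand side);
* `energyDensityTT'_le_qfpCellEnergyTT'_named` — the certificate theorem restated through the name;
* `hamiltonian_eq_smul_add_smul` — `H_G(t,U) = t • H_G(1,0) + U • H_G(0,1)`;
* **`qfpCellEnergyTT'_affine`** — `𝒞(t,t',U) = t·𝒞(1,0,0) + t'·𝒞(0,1,0) + U·𝒞(0,0,1)`;
* **`energyDensityTT'_le_qfpPlaneTT'`** — for all real `t, t'` and `U ≥ 0`: `e(t,t',U;n̄) ≤ t·A + t'·B + U·D` with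
  `A = 𝒞(1,0,0)`, `B = 𝒞(0,1,0)`, `D = 𝒞(0,0,1)` — the cap PLANE of the hubbard-fast QFPTP layer.
Sources: Bach–Lieb–Solovej 1994 (2c.36) [BachLiebSolovej1994]. Everything proved; one definition with a body.
-/

noncomputable section

namespace Summit.Ventures.CertifiedManyBodySolver.Upper

open Matrix Finset Filter
open Literature.MathematicalPhysics.QuantumLattice Literature.MathematicalPhysics.QuantumLattice.HartreeFock
  Literature.MathematicalPhysics.QuantumLattice.ThermodynamicLimit HeisenbergTL HubbardWave0 PlaquetteLUC
open scoped ComplexOrder ComplexConjugate Topology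

variable {M : Fin 2 → ℕ} [∀ i, NeZero (M i)] {q : Fin 2 → ℕ}

/-- **The `t–t'` plaquette-dressed cell energy per site** on a (shrunk, finitely supported) kernel `γ σ R` with a cell-periodic layer `v`
of plaquette gates: the right-hand side of `energyDensityTT'_le_qfpCellEnergyTT'` — plaquette windows of `γ_σ(0)` against
`v_rᴴ(H_plaq(t,U) + D_plaq(t'))v_r`, axial-link windows of `γ_σ(0), γ_σ(∓e_j)` against `V_{r,j}ᴴ(T_j(t) + D_j(t'))V_{r,j}`, and the two
kinds of corner windows of `γ_σ(-u)`, `u ∈ {0,±1}²`, against `W_{r,d}ᴴ C_d(t') W_{r,d}`, divided by `|cell|`. [cite: BachLiebSolovej1994, eq. (2c.36)] -/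
def qfpCellEnergyTT' (hq0 : ∀ i, 0 < q i) (γ : Fin 2 → (Fin 2 → ℤ) → Matrix (RectTorusSite M) (RectTorusSite M) ℂ)
    (v : ((i : Fin 2) → Fin (q i)) → Matrix (Finset (Orb (FermionTorus 2 2))) (Finset (Orb (FermionTorus 2 2))) ℂ)
    (t t' U : ℝ) : ℝ :=
  ((∑ r : (i : Fin 2) → Fin (q i), ∑ s : Finset (Orb (FermionTorus 2 2)), ∑ s' : Finset (Orb (FermionTorus 2 2)),
              ((v r)ᴴ * (hamiltonian plaquetteGraph t U + hamiltonian plaquetteDiagGraph t' 0) * v r) s s' *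
                slaterRDM (Matrix.of fun o o' : Orb (FermionTorus 2 2) => if (ofLex o).2 = (ofLex o').2 then
                  γ (ofLex o).2 0 (fun i => (((ofLex (ofLex o).1 i : ℕ) + 2 * (r i : ℕ) : ℕ) : ZMod (M i)))
                    (fun i => (((ofLex (ofLex o').1 i : ℕ) + 2 * (r i : ℕ) : ℕ) : ZMod (M i))) else 0) s s') +
          ((∑ r : (i : Fin 2) → Fin (q i), ∑ j : Fin 2, ∑ s : Finset (Orb (Fin 2 ×ₗ FermionTorus 2 2)), ∑ s' : Finset (Orb (Fin 2 ×ₗ FermionTorus 2 2)),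
              ((fermionEmbed inlCell (v r) * fermionEmbed inrCell
                    (v (fun i => ⟨(if i = j then (r i : ℕ) + 1 else (r i : ℕ)) % q i, Nat.mod_lt _ (hq0 i)⟩)))ᴴ *
                  (hamiltonian (linkGraph j) t 0 + hamiltonian (linkDiagGraph j) t' 0) *
                  (fermionEmbed inlCell (v r) * fermionEmbed inrCell
                    (v (fun i => ⟨(if i = j then (r i : ℕ) + 1 else (r i : ℕ)) % q i, Nat.mod_lt _ (hq0 i)⟩)))) s s' *
                slaterRDM (Matrix.of fun o o' : Orb (Fin 2 ×ₗ FermionTorus 2 2) => if (ofLex o).2 = (ofLex o').2 then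
                  (if (ofLex (ofLex o).1).1 = 0 then
                      (if (ofLex (ofLex o').1).1 = 0 then γ (ofLex o).2 0 else if (r j : ℕ) + 1 < q j then γ (ofLex o).2 0 else γ (ofLex o).2 (Pi.single j 1))
                    else
                      (if (ofLex (ofLex o').1).1 = 0 then (if (r j : ℕ) + 1 < q j then γ (ofLex o).2 0 else γ (ofLex o).2 (-Pi.single j 1))
                        else γ (ofLex o).2 0))
                    (fun i => (((ofLex (ofLex (ofLex o).1).2 i : ℕ) + 2 * (if (ofLex (ofLex o).1).1 = 0 then (r i : ℕ) else
                      if i = j then ((r j : ℕ) + 1) % q j else (r i : ℕ)) : ℕ) : ZMod (M i)))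
                    (fun i => (((ofLex (ofLex (ofLex o').1).2 i : ℕ) + 2 * (if (ofLex (ofLex o').1).1 = 0 then (r i : ℕ) else
                      if i = j then ((r j : ℕ) + 1) % q j else (r i : ℕ)) : ℕ) : ZMod (M i))) else 0) s s') +
          (∑ r : (i : Fin 2) → Fin (q i),
            ((∑ s : Finset (Orb (Fin 2 ×ₗ FermionTorus 2 2)), ∑ s' : Finset (Orb (Fin 2 ×ₗ FermionTorus 2 2)),
              ((fermionEmbed inlCell (v r) * fermionEmbed inrCell
                (v (fun i => ⟨((r i : ℕ) + 1) % q i, Nat.mod_lt _ (hq0 i)⟩)))ᴴ * hamiltonian (cornerGraph 0) t' 0 *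
              (fermionEmbed inlCell (v r) * fermionEmbed inrCell
                (v (fun i => ⟨((r i : ℕ) + 1) % q i, Nat.mod_lt _ (hq0 i)⟩)))) s s' *
            slaterRDM (Matrix.of fun o o' : Orb (Fin 2 ×ₗ FermionTorus 2 2) => if (ofLex o).2 = (ofLex o').2 then
              (fun u : Fin 2 → ℤ => γ (ofLex o).2 (-u)) ((if (ofLex (ofLex o).1).1 = 0 then (0 : Fin 2 → ℤ) else
                    ((if (r 0 : ℕ) + 1 < q 0 then 0 else Pi.single 0 1) + (if (r 1 : ℕ) + 1 < q 1 then 0 else Pi.single 1 1))) -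
                  (if (ofLex (ofLex o').1).1 = 0 then (0 : Fin 2 → ℤ) else
                    ((if (r 0 : ℕ) + 1 < q 0 then 0 else Pi.single 0 1) + (if (r 1 : ℕ) + 1 < q 1 then 0 else Pi.single 1 1))))
                  (fun i => (((ofLex (ofLex (ofLex o).1).2 i : ℕ) + 2 * (if (ofLex (ofLex o).1).1 = 0 then (r i : ℕ) else
                    ((r i : ℕ) + 1) % q i) : ℕ) : ZMod (M i)))
                  (fun i => (((ofLex (ofLex (ofLex o').1).2 i : ℕ) + 2 * (if (ofLex (ofLex o').1).1 = 0 then (r i : ℕ) else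
                    ((r i : ℕ) + 1) % q i) : ℕ) : ZMod (M i))) else 0) s s') +
            (∑ s : Finset (Orb (Fin 2 ×ₗ FermionTorus 2 2)), ∑ s' : Finset (Orb (Fin 2 ×ₗ FermionTorus 2 2)),
              ((fermionEmbed inlCell (v (fun i => ⟨(if i = 1 then (r i : ℕ) + 1 else (r i : ℕ)) % q i, Nat.mod_lt _ (hq0 i)⟩)) *
              fermionEmbed inrCell (v (fun i => ⟨(if i = 0 then (r i : ℕ) + 1 else (r i : ℕ)) % q i, Nat.mod_lt _ (hq0 i)⟩)))ᴴ *
              hamiltonian (cornerGraph 1) t' 0 *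
              (fermionEmbed inlCell (v (fun i => ⟨(if i = 1 then (r i : ℕ) + 1 else (r i : ℕ)) % q i, Nat.mod_lt _ (hq0 i)⟩)) *
                fermionEmbed inrCell (v (fun i => ⟨(if i = 0 then (r i : ℕ) + 1 else (r i : ℕ)) % q i, Nat.mod_lt _ (hq0 i)⟩)))) s s' *
            slaterRDM (Matrix.of fun o o' : Orb (Fin 2 ×ₗ FermionTorus 2 2) => if (ofLex o).2 = (ofLex o').2 then
              (fun u : Fin 2 → ℤ => γ (ofLex o).2 (-u)) ((if (ofLex (ofLex o).1).1 = 0 then (if (r 1 : ℕ) + 1 < q 1 then (0 : Fin 2 → ℤ) else Pi.single 1 1) else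
                    (if (r 0 : ℕ) + 1 < q 0 then (0 : Fin 2 → ℤ) else Pi.single 0 1)) -
                  (if (ofLex (ofLex o').1).1 = 0 then (if (r 1 : ℕ) + 1 < q 1 then (0 : Fin 2 → ℤ) else Pi.single 1 1) else
                    (if (r 0 : ℕ) + 1 < q 0 then (0 : Fin 2 → ℤ) else Pi.single 0 1)))
                  (fun i => (((ofLex (ofLex (ofLex o).1).2 i : ℕ) + 2 * (if i = (if (ofLex (ofLex o).1).1 = 0 then 1 else 0) then
                    ((r i : ℕ) + 1) % q i else (r i : ℕ)) : ℕ) : ZMod (M i)))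
                  (fun i => (((ofLex (ofLex (ofLex o').1).2 i : ℕ) + 2 * (if i = (if (ofLex (ofLex o').1).1 = 0 then 1 else 0) then
                    ((r i : ℕ) + 1) % q i else (r i : ℕ)) : ℕ) : ZMod (M i))) else 0) s s'))))).re /
          ∏ i, (M i : ℝ)

/-- **The certificate theorem through the name**: under the hypotheses of `energyDensityTT'_le_qfpCellEnergyTT'`,
`e(t,t',U;n̄) ≤ qfpCellEnergyTT' (γ = shrunk kernel) v t t' U`. [cite: BachLiebSolovej1994, eq. (2c.36)] -/
theorem energyDensityTT'_le_qfpCellEnergyTT'_named (hq : ∀ i, M i = 2 * q i) (hq0 : ∀ i, 0 < q i)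
    (k₀ : Fin 2 → ℕ) (m₀ : ℕ) (hk₀ : ∀ i, k₀ i * M i = m₀ * 2) (t t' : ℝ) {U : ℝ} (hU : 0 ≤ U)
    (S : Finset (Fin 2 → ℤ)) (Rc : Fin 2 → ℕ) (hRc : ∀ R ∈ S, ∀ i, |R i| ≤ Rc i) (hkRc : ∀ i, Rc i + 2 ≤ k₀ i)
    (h0S : (0 : Fin 2 → ℤ) ∈ S) (hSneg : ∀ R ∈ S, -R ∈ S)
    (γt : Fin 2 → (Fin 2 → ℤ) → Matrix (RectTorusSite M) (RectTorusSite M) ℂ)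
    (hγtS : ∀ σ, ∀ R ∉ S, γt σ R = 0) (hγt : ∀ σ R, γt σ (-R) = (γt σ R)ᴴ)
    (c : Fin 2 → (Fin 2 → ℤ) → ℝ)
    (hc : ∀ σ, ∀ T ∈ defectSupport S, Real.sqrt (∑ i, ∑ j, ‖defectKernel S (γt σ) T i j‖ ^ 2) ≤ c σ T)
    (a b : Fin 2 → ℝ) (ha : ∀ σ, 0 ≤ a σ) (hab : ∀ σ, a σ * (∑ T ∈ defectSupport S, c σ T) ≤ b σ)
    (hab1 : ∀ σ, a σ * (1 + ∑ T ∈ defectSupport S, c σ T) + b σ ≤ 1)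
    (hn0 : 0 < (∑ σ, (shrinkKernel (γt σ) (a σ) (b σ) 0).trace).re / ∏ i, (M i : ℝ))
    (hn2 : (∑ σ, (shrinkKernel (γt σ) (a σ) (b σ) 0).trace).re / ∏ i, (M i : ℝ) < 2)
    (v : ((i : Fin 2) → Fin (q i)) → Matrix (Finset (Orb (FermionTorus 2 2))) (Finset (Orb (FermionTorus 2 2))) ℂ)
    (hv : ∀ r, (v r)ᴴ * v r = 1) (hvN : ∀ r, Commute totalNumberOp (v r)) :
    energyDensityTT' t t' U ((∑ σ, (shrinkKernel (γt σ) (a σ) (b σ) 0).trace).re / ∏ i, (M i : ℝ)) ≤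
      qfpCellEnergyTT' hq0 (fun σ => shrinkKernel (γt σ) (a σ) (b σ)) v t t' U :=
  energyDensityTT'_le_qfpCellEnergyTT' hq hq0 k₀ m₀ hk₀ t t' hU S Rc hRc hkRc h0S hSneg γt hγtS hγt c hc a b ha hab hab1 hn0 hn2 v hv hvN

/-- `H_G(t,U) = t • H_G(1,0) + U • H_G(0,1)`: the Hubbard Hamiltonian of a graph is linear in its two couplings. [folklore] -/
theorem hamiltonian_eq_smul_add_smul {Λ : Type*} [LinearOrder Λ] [Fintype Λ] (G : SimpleGraph Λ) [DecidableRel G.Adj] (t U : ℝ) :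
    hamiltonian G t U = (t : ℂ) • hamiltonian G 1 0 + (U : ℂ) • hamiltonian G 0 1 := by
  simp only [hamiltonian, Complex.ofReal_zero, Complex.ofReal_one, zero_smul, add_zero, neg_smul, one_smul,
    smul_neg, neg_zero, zero_add]

/-- `H_G(0,0) = 0`. [folklore] -/
theorem hamiltonian_zero_zero {Λ : Type*} [LinearOrder Λ] [Fintype Λ] (G : SimpleGraph Λ) [DecidableRel G.Adj] :
    hamiltonian G 0 0 = 0 := by
  simp only [hamiltonian, Complex.ofReal_zero, zero_smul, neg_zero, add_zero]

/-- The window functional `X ↦ Σ_{s,s'} (gᴴ X g)_{ss'} ρ_{ss'}` is additive. [folklore] -/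
theorem sum_conj_add {ι : Type*} [Fintype ι] [DecidableEq ι] (g X Y : Matrix ι ι ℂ) (ρ : ι → ι → ℂ) :
    ∑ s, ∑ s', (gᴴ * (X + Y) * g) s s' * ρ s s' =
      ∑ s, ∑ s', (gᴴ * X * g) s s' * ρ s s' + ∑ s, ∑ s', (gᴴ * Y * g) s s' * ρ s s' := by
  simp only [Matrix.mul_add, Matrix.add_apply, add_mul, Finset.sum_add_distrib]

/-- The window functional `X ↦ Σ_{s,s'} (gᴴ X g)_{ss'} ρ_{ss'}` is homogeneous. [folklore] -/
theorem sum_conj_smul {ι : Type*} [Fintype ι] [DecidableEq ι] (g X : Matrix ι ι ℂ) (ρ : ι → ι → ℂ) (a : ℂ) :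
    ∑ s, ∑ s', (gᴴ * (a • X) * g) s s' * ρ s s' = a * ∑ s, ∑ s', (gᴴ * X * g) s s' * ρ s s' := by
  simp only [Matrix.mul_smul, Matrix.smul_mul, Matrix.smul_apply, smul_eq_mul, Finset.mul_sum, mul_assoc]

/-- The window functional vanishes on the zero operator. [folklore] -/
theorem sum_conj_zero {ι : Type*} [Fintype ι] [DecidableEq ι] (g : Matrix ι ι ℂ) (ρ : ι → ι → ℂ) :
    ∑ s, ∑ s', (gᴴ * (0 : Matrix ι ι ℂ) * g) s s' * ρ s s' = 0 := by
  simp only [Matrix.mul_zero, Matrix.zero_apply, zero_mul, Finset.sum_const_zero]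

omit [∀ i, NeZero (M i)] in
set_option maxHeartbeats 4000000 in
/-- **Affine read-off**: the dressed cell energy is affine (indeed linear) in the couplings,
`𝒞(t,t',U) = t·𝒞(1,0,0) + t'·𝒞(0,1,0) + U·𝒞(0,0,1)` — a fixed state's energy is linear in `(t, t', U)`. [folklore] -/
theorem qfpCellEnergyTT'_affine (hq0 : ∀ i, 0 < q i) (γ : Fin 2 → (Fin 2 → ℤ) → Matrix (RectTorusSite M) (RectTorusSite M) ℂ)
    (v : ((i : Fin 2) → Fin (q i)) → Matrix (Finset (Orb (FermionTorus 2 2))) (Finset (Orb (FermionTorus 2 2))) ℂ)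
    (t t' U : ℝ) :
    qfpCellEnergyTT' hq0 γ v t t' U =
      t * qfpCellEnergyTT' hq0 γ v 1 0 0 + t' * qfpCellEnergyTT' hq0 γ v 0 1 0 + U * qfpCellEnergyTT' hq0 γ v 0 0 1 := by
  unfold qfpCellEnergyTT'
  simp only [hamiltonian_eq_smul_add_smul _ t U, hamiltonian_eq_smul_add_smul _ t 0, hamiltonian_eq_smul_add_smul _ t' 0,
    hamiltonian_zero_zero, Complex.ofReal_zero, zero_smul, add_zero, zero_add, sum_conj_add, sum_conj_smul, sum_conj_zero,
    Finset.sum_const_zero, Complex.re_sum, Complex.add_re, Complex.re_ofReal_mul, Finset.sum_add_distrib, ← Finset.mul_sum]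
  ring

/-- **The cap PLANE of a plaquette-dressed certificate (FORMAT-qfp1) — the theorem the hubbard-fast QFPTP layer cites.** Under the
hypotheses of `energyDensityTT'_le_qfpCellEnergyTT'` (kernel / shrink data, reader duties, cell-periodic gates), for ALL real `t, t'`
and `U ≥ 0`: `e(t,t',U;n̄) ≤ t·A + t'·B + U·D` with the three `(t,t',U)`-INDEPENDENT numbers `A = 𝒞(1,0,0)` (nearest-neighbour kinetic
part), `B = 𝒞(0,1,0)` (diagonal kinetic part, corner windows included), `D = 𝒞(0,0,1)` (interaction part) of the dressed cell energy
`qfpCellEnergyTT'` — one certificate, one plane of caps over the whole `(t', U ≥ 0)` half-space. [cite: BachLiebSolovej1994, eq. (2c.36)] -/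
theorem energyDensityTT'_le_qfpPlaneTT' (hq : ∀ i, M i = 2 * q i) (hq0 : ∀ i, 0 < q i)
    (k₀ : Fin 2 → ℕ) (m₀ : ℕ) (hk₀ : ∀ i, k₀ i * M i = m₀ * 2) (t t' : ℝ) {U : ℝ} (hU : 0 ≤ U)
    (S : Finset (Fin 2 → ℤ)) (Rc : Fin 2 → ℕ) (hRc : ∀ R ∈ S, ∀ i, |R i| ≤ Rc i) (hkRc : ∀ i, Rc i + 2 ≤ k₀ i)
    (h0S : (0 : Fin 2 → ℤ) ∈ S) (hSneg : ∀ R ∈ S, -R ∈ S)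
    (γt : Fin 2 → (Fin 2 → ℤ) → Matrix (RectTorusSite M) (RectTorusSite M) ℂ)
    (hγtS : ∀ σ, ∀ R ∉ S, γt σ R = 0) (hγt : ∀ σ R, γt σ (-R) = (γt σ R)ᴴ)
    (c : Fin 2 → (Fin 2 → ℤ) → ℝ)
    (hc : ∀ σ, ∀ T ∈ defectSupport S, Real.sqrt (∑ i, ∑ j, ‖defectKernel S (γt σ) T i j‖ ^ 2) ≤ c σ T)
    (a b : Fin 2 → ℝ) (ha : ∀ σ, 0 ≤ a σ) (hab : ∀ σ, a σ * (∑ T ∈ defectSupport S, c σ T) ≤ b σ)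
    (hab1 : ∀ σ, a σ * (1 + ∑ T ∈ defectSupport S, c σ T) + b σ ≤ 1)
    (hn0 : 0 < (∑ σ, (shrinkKernel (γt σ) (a σ) (b σ) 0).trace).re / ∏ i, (M i : ℝ))
    (hn2 : (∑ σ, (shrinkKernel (γt σ) (a σ) (b σ) 0).trace).re / ∏ i, (M i : ℝ) < 2)
    (v : ((i : Fin 2) → Fin (q i)) → Matrix (Finset (Orb (FermionTorus 2 2))) (Finset (Orb (FermionTorus 2 2))) ℂ)
    (hv : ∀ r, (v r)ᴴ * v r = 1) (hvN : ∀ r, Commute totalNumberOp (v r)) :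
    energyDensityTT' t t' U ((∑ σ, (shrinkKernel (γt σ) (a σ) (b σ) 0).trace).re / ∏ i, (M i : ℝ)) ≤
      t * qfpCellEnergyTT' hq0 (fun σ => shrinkKernel (γt σ) (a σ) (b σ)) v 1 0 0 +
        t' * qfpCellEnergyTT' hq0 (fun σ => shrinkKernel (γt σ) (a σ) (b σ)) v 0 1 0 +
          U * qfpCellEnergyTT' hq0 (fun σ => shrinkKernel (γt σ) (a σ) (b σ)) v 0 0 1 := by
  rw [← qfpCellEnergyTT'_affine]
  exact energyDensityTT'_le_qfpCellEnergyTT'_named hq hq0 k₀ m₀ hk₀ t t' hU S Rc hRc hkRc h0S hSneg γt hγtS hγt c hc a b ha hab hab1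
    hn0 hn2 v hv hvN

end Summit.Ventures.CertifiedManyBodySolver.Upper
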